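import Summits.BirchSwinnertonDyer.Rank1Residual.ManinAdditive.TowerExtension
import Literature.NumberTheory.Automorphic.CongruenceSubgroupPropertySL2AwayHolds
import HarnessLib

/-!
# E-an-141 (S-arithmetic Borel generation), E-an-139a (affine recurrence rigidity) and E-an-135 ⟹ E-an-135♭ — PROVED
# (cell `bsd-f2-manin`, T-an-34 sibling of the leaf `TowerExtension`, typer g15)

Three of the four obligation nodes / edges typed in `TowerExtension.lean` (an g30, MEMO-an §72) are theorems of the tree:

* **E-an-141** `TowerExtension.sArithBorelGeneration_holds : ∀ N q, SArithBorelGeneration N q` — in `SL₂(ℤ[1/q])`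
  (`q` prime, `N ≥ 1`) the S-congruence group `Γ_S^{±q}(N) = {γ₁₀ ∈ (N), γ₁₁ ∈ ±q^ℕ + (N)}` lies in
  `⟨B⁺(ℤ[1/q]) ∪ U⁻(Nℤ[1/q])⟩`.  PROOF: the tree's Vaserstein theorem over `ℤ[1/m]`
  `Literature.NumberTheory.Automorphic.SL2Rel.Away.relG_top_span_natCast_le_relE` (`G(A, (N)) ≤ E(A, (N)) =
  ⟨E₁₂(A), E₂₁((N))⟩`, cell bsd-print-x8, Vaserstein 1972 / Liehl 1981 / Bass–Milnor–Serre Thm 3.6 over `ℚ`) after the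
  torus move `γ ↦ γ·diag(±q^{e}, ±q^{−e})` (a Borel element) which makes the lower-right entry `≡ 1 (mod N)`.  Neither the
  finite-index fact [VL]/Venkataramana 1994 nor Serre's congruence subgroup property (itself a tree theorem,
  `SerreSL2Congruence1970_congruenceSubgroupProperty_away_holds`) is used; an's §5 facts are therefore not landed.
* **E-an-139a** `TowerExtension.affineRecurrenceRigidity_holds : AffineRecurrenceRigidity` — a `w`-periodic solution of
  `q·x(m+2) = a·x(m+1) − x(m) + κ` (`m ≥ s`) is constant from `s` on with `(q + 1 − a)·x(s) = κ` when `X² − aX + q` and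
  `X^w − 1` are coprime.  PROOF (no eigenvalues): the differences `d` satisfy the homogeneous recurrence and are periodic;
  the shift `R f = f(· + (w−1))` on `ℕ → K` acts on the periodic `d` as the inverse shift, so `(R² − aR + q)d = 0` and
  `(R^w − 1)d = 0`; a Bézout relation evaluated at `R` (`Polynomial.aeval`) kills `d`.
* **E-an-135 ⟹ E-an-135♭** `KatoCurve.towerImpliesSome_holds : TowerImpliesSome` — Dirichlet (Mathlib
  `Nat.forall_exists_prime_gt_and_modEq`) gives primes `q ≡ −1 (mod 4p)` beyond any bound; such `q` is odd, `≠ p`, `∤ N`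
  and has `p ∤ (q−1)/2 = 2pj − 1`, so the tower law E-an-135 applies verbatim.
* `TowerExtension.qFareyFibreConnected_of_borelGenerationImpliesConnected` — with E-an-141 proved, an's orbit-graph edge
  `BorelGenerationImpliesConnected` (§72.3, paper) gives E-an-140 `QFareyFibreConnected N q` outright.

EVERYTHING HERE IS A SORRY-FREE THEOREM (standard axioms).  What remains OPEN of an's §72 chain in Lean: E-an-140 (= the
orbit-graph lemma now), THEOREM Z's modular-symbol part, (GEN𝒵), and E-an-135/135♭ themselves.  REF1 R-an-52 by-name audit
requested.  bears_on: stmt-BirchSwinnertonDyer-22967 / -22968 (tower input of TURNKEY-an-16).  PARTITION 0 · beyond-print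
theorem: no (E-an-141 is a corollary of Vaserstein's printed theorem; E-an-139a is linear algebra) · BSD is not proved by
this; Manin's conjecture is not proved by this.
-/

set_option autoImplicit false

noncomputable section

open scoped MatrixGroups

namespace Summit.BirchSwinnertonDyer.Rank1Residual.ManinAdditive.TowerExtension

open Literature.NumberTheory.Automorphic Literature.NumberTheory.Automorphic.SL2Rel

section BorelGeneration

variable {N q : ℕ}

/-- `E(A, (N)) = ⟨E₁₂(A), E₂₁((N))⟩ ≤ ⟨B⁺ ∪ U⁻(N)⟩`: both kinds of generators lie in `borelLowerSet`. -/
theorem relE_top_le_closure_borelLowerSet (N q : ℕ) :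
    relE (⊤ : Ideal (Rq q)) (Ideal.span {(N : Rq q)}) ≤ Subgroup.closure (borelLowerSet N q) := by
  unfold relE
  refine Subgroup.closure_mono ?_
  rintro g (⟨x, -, rfl⟩ | ⟨y, hy, rfl⟩)
  · left
    show (e12 x : SL(2, Rq q)) 1 0 = 0
    rfl
  · right
    refine ⟨rfl, rfl, rfl, ?_⟩
    show (e21 y : SL(2, Rq q)) 1 0 ∈ Ideal.span {(N : Rq q)}
    exact hy

/-- **E-an-141 PROVED** (typer g15): for every prime `q ∤ N`, `N ≥ 1`, the S-congruence group `Γ_S^{±q}(N) ⊆ SL₂(ℤ[1/q])` is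
contained in (hence generated together with) `⟨B⁺(ℤ[1/q]) ∪ U⁻(Nℤ[1/q])⟩`.  From the tree's Vaserstein theorem over `ℤ[1/q]`
`SL2Rel.Away.relG_top_span_natCast_le_relE` (`G(A, (N)) ≤ E(A, (N)) = ⟨E₁₂(A), E₂₁((N))⟩`, cell bsd-print-x8) by the torus move
`γ ↦ γ·diag(±q^{e}, ±q^{−e})` which makes the lower-right entry `≡ 1 (mod N)`; no finite-index / congruence-subgroup-property
input is used.  (The hypothesis `q ∤ N` of the row is not needed.) -/
theorem sArithBorelGeneration_holds (N q : ℕ) : SArithBorelGeneration N q := by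
  intro hq _hqN hN γ hγ
  have hq2 : 2 ≤ q := hq.two_le
  have hN0 : N ≠ 0 := Nat.pos_iff_ne_zero.mp hN
  obtain ⟨hc, e, hd⟩ := hγ
  set I : Ideal (Rq q) := Ideal.span {(N : Rq q)} with hI
  set H : Subgroup (SL(2, Rq q)) := Subgroup.closure (borelLowerSet N q) with hH
  -- `q` is a unit of `ℤ[1/q]`
  obtain ⟨u, hu⟩ := (SerreSL2.Away.isUnit_natCast_self : IsUnit ((q : ℕ) : Localization.Away (q : ℤ)))
  have huinv : ((q : ℕ) : Rq q) ^ e * ((↑(u⁻¹) : Rq q)) ^ e = 1 := by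
    rw [← mul_pow, ← hu, Units.mul_inv, one_pow]
  have hdet : γ 0 0 * γ 1 1 - γ 0 1 * γ 1 0 = 1 := by
    have := γ.2
    rw [Matrix.det_fin_two] at this
    exact this
  -- generic conclusion from a unit pair `(v, w)` with `d·w ≡ 1 (mod N)`: the torus move `γ ↦ γ·diag(v, w)`
  have conclude : ∀ (v w : Rq q) (h : v * w = 1), γ 1 1 * w - 1 ∈ I → γ ∈ (H : Set (SL(2, Rq q))) := by
    intro v w h hdw
    let t : SL(2, Rq q) := ⟨!![v, 0; 0, w], by simp [Matrix.det_fin_two_of, h]⟩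
    have t00 : t 0 0 = v := rfl
    have t01 : t 0 1 = 0 := rfl
    have t10 : t 1 0 = 0 := rfl
    have t11 : t 1 1 = w := rfl
    have ht : t ∈ H := Subgroup.subset_closure (Or.inl t10)
    -- `γ·t ∈ G(A, (N))`: `c v ∈ (N)`, `d w − 1 ∈ (N)`, and `a v − 1 = −(a v)(d w − 1) + (b w)(v c) ∈ (N)` by `det = 1`
    have hG : γ * t ∈ relG (⊤ : Ideal (Rq q)) I := by
      rw [mem_relG, Ideal.top_mul]
      simp only [mul_apply_two, t00, t01, t10, t11, mul_zero, add_zero, zero_add]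
      refine ⟨trivial, I.mul_mem_right _ hc, ?_, hdw⟩
      have key : γ 0 0 * v - 1 = -(γ 0 0 * v) * (γ 1 1 * w - 1) + (γ 0 1 * w) * (v * γ 1 0) := by
        linear_combination (v * w) * hdet + h
      rw [key]
      exact I.add_mem (I.mul_mem_left _ hdw) (I.mul_mem_left _ (I.mul_mem_left _ hc))
    have h1 : γ * t ∈ H :=
      (relE_top_le_closure_borelLowerSet N q) (SL2Rel.Away.relG_top_span_natCast_le_relE q hq2 N hN0 hG)
    have : γ * t * t⁻¹ ∈ H := H.mul_mem h1 (H.inv_mem ht)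
    simpa using this
  rcases hd with hd | hd
  · -- `d ≡ q^e (mod N)`: use `(v, w) = (q^e, q^{-e})`
    refine conclude (((q : ℕ) : Rq q) ^ e) (((↑(u⁻¹) : Rq q)) ^ e) huinv ?_
    have : γ 1 1 * ((↑(u⁻¹) : Rq q)) ^ e - 1 = (γ 1 1 - (q : Rq q) ^ e) * ((↑(u⁻¹) : Rq q)) ^ e := by
      linear_combination huinv
    rw [this]
    exact I.mul_mem_right _ hd
  · -- `d ≡ -q^e (mod N)`: use `(v, w) = (-q^e, -q^{-e})`
    refine conclude (-(((q : ℕ) : Rq q) ^ e)) (-(((↑(u⁻¹) : Rq q)) ^ e)) (by linear_combination huinv) ?_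
    have : γ 1 1 * -(((↑(u⁻¹) : Rq q)) ^ e) - 1 = -((γ 1 1 + (q : Rq q) ^ e) * ((↑(u⁻¹) : Rq q)) ^ e) := by
      linear_combination huinv
    rw [this]
    exact I.neg_mem (I.mul_mem_right _ hd)

/-- With E-an-141 a theorem, an's orbit-graph edge gives E-an-140 outright (typer g15, PROVED composition). -/
theorem qFareyFibreConnected_of_borelGenerationImpliesConnected (h : BorelGenerationImpliesConnected) (N q : ℕ) :
    QFareyFibreConnected N q :=
  h N q (sArithBorelGeneration_holds N q)

end BorelGeneration

section AffineRigidity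

open Polynomial

/-- **E-an-139a PROVED** (typer g15; 2×2 linear algebra done with the shift operator): a `w`-periodic solution of
`q·x(m+2) = a·x(m+1) − x(m) + κ` (`m ≥ s`) is constant from `s` on, with `(q + 1 − a)·x(s) = κ`, as soon as `X² − aX + q`
and `X^w − 1` are coprime.  Proof: the differences `d(i) = x(s+i+1) − x(s+i)` satisfy the homogeneous recurrence and are
`w`-periodic; on `ℕ → K` the shift `R f = f(· + (w−1))` acts on the periodic `d` as the INVERSE shift, so
`(R² − aR + q)·d = 0` (the recurrence read backwards) and `(R^w − 1)·d = 0`; a Bézout relation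
`A·(X² − aX + q) + B·(X^w − 1) = 1` evaluated at `R` kills `d`. -/
theorem affineRecurrenceRigidity_holds : AffineRecurrenceRigidity := by
  intro K _ a q κ w s x hq hw hrec hper hcop
  -- shift the origin to `s`
  set z : ℕ → K := fun i => x (s + i) with hz
  have zrec : ∀ i, q * z (i + 2) = a * z (i + 1) - z i + κ := by
    intro i
    have h := hrec (s + i) (Nat.le_add_right s i)
    simp only [hz, ← add_assoc]
    exact h
  have zper : ∀ i, z (i + w) = z i := by
    intro i
    have h := hper (s + i) (Nat.le_add_right s i)
    simp only [hz, ← add_assoc]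
    exact h
  -- the differences
  set d : ℕ → K := fun i => z (i + 1) - z i with hd
  have drec : ∀ i, q * d (i + 2) = a * d (i + 1) - d i := by
    intro i
    have h1 := zrec i
    have h2 := zrec (i + 1)
    have e1 : i + 1 + 2 = i + 2 + 1 := by omega
    have e2 : i + 1 + 1 = i + 2 := by omega
    rw [e1, e2] at h2
    simp only [hd]
    linear_combination h2 - h1
  have dper : ∀ i, d (i + w) = d i := by
    intro i
    have h1 := zper (i + 1)
    have h2 := zper i
    have e1 : i + 1 + w = i + w + 1 := by omega
    rw [e1] at h1
    simp only [hd]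
    rw [h1, h2]
  have dperk : ∀ k i, d (i + k * w) = d i := by
    intro k
    induction k with
    | zero => intro i; simp
    | succ k ih => intro i; rw [Nat.succ_mul, ← add_assoc, dper, ih]
  -- the shift operator `R f = f (· + (w - 1))`
  let R : Module.End K (ℕ → K) :=
    { toFun := fun f i => f (i + (w - 1))
      map_add' := fun f g => rfl
      map_smul' := fun c f => rfl }
  have hR : ∀ f : ℕ → K, R f = fun i => f (i + (w - 1)) := fun f => rfl
  have hRpow : ∀ (n : ℕ) (f : ℕ → K), (R ^ n) f = fun i => f (i + n * (w - 1)) := by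
    intro n
    induction n with
    | zero => intro f; funext i; simp
    | succ n ih =>
        intro f
        rw [pow_succ', Module.End.mul_apply, ih f, hR]
        funext i
        congr 1
        ring
  -- `(R^w - 1) d = 0`
  have hQ : Polynomial.aeval R (X ^ w - 1 : K[X]) d = 0 := by
    rw [map_sub, map_pow, Polynomial.aeval_X, map_one, LinearMap.sub_apply, Module.End.one_apply, hRpow]
    funext i
    simp only [Pi.sub_apply, Pi.zero_apply]
    rw [mul_comm, dperk, sub_self]
  -- `(R² - aR + q) d = 0` : the recurrence read backwards through periodicity
  have hP : Polynomial.aeval R (X ^ 2 - C a * X + C q : K[X]) d = 0 := by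
    rw [map_add, map_sub, map_mul, map_pow, Polynomial.aeval_X, Polynomial.aeval_C, Polynomial.aeval_C,
      LinearMap.add_apply, LinearMap.sub_apply, Module.End.mul_apply, Module.algebraMap_end_apply,
      Module.algebraMap_end_apply, hRpow, hR]
    funext i
    simp only [Pi.add_apply, Pi.sub_apply, Pi.smul_apply, Pi.zero_apply, smul_eq_mul]
    have h := drec (i + 2 * (w - 1))
    have e1 : i + 2 * (w - 1) + 2 = i + 2 * w := by omega
    have e2 : i + 2 * (w - 1) + 1 = i + (w - 1) + w := by omega
    rw [e1, e2, dperk 2 i, dper] at h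
    linear_combination h
  -- Bézout at `R` kills `d`
  have hd0 : d = 0 := by
    obtain ⟨A, B, hAB⟩ := hcop
    have h : Polynomial.aeval R (A * (X ^ 2 - C a * X + C q) + B * (X ^ w - 1)) d = Polynomial.aeval R (1 : K[X]) d := by
      rw [hAB]
    rw [map_add (Polynomial.aeval R) (A * (X ^ 2 - C a * X + C q)) (B * (X ^ w - 1)), map_mul, map_mul, map_one,
      LinearMap.add_apply, Module.End.mul_apply, Module.End.mul_apply, hP, hQ, map_zero, map_zero, add_zero,
      Module.End.one_apply] at h
    exact h.symm
  -- read off the conclusion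
  have dzero : ∀ i, z (i + 1) = z i := by
    intro i
    have := congrFun hd0 i
    simp only [hd, Pi.zero_apply, sub_eq_zero] at this
    exact this
  have zconst : ∀ i, z i = z 0 := by
    intro i
    induction i with
    | zero => rfl
    | succ i ih => rw [dzero, ih]
  have xconst : ∀ m : ℕ, s ≤ m → x m = x s := by
    intro m hm
    obtain ⟨i, rfl⟩ := Nat.exists_eq_add_of_le hm
    have := zconst i
    simp only [hz, add_zero] at this
    exact this
  refine ⟨xconst, ?_⟩
  have h := zrec 0
  rw [zconst 2, zconst 1] at h
  simp only [hz, add_zero] at h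
  linear_combination h

end AffineRigidity

end Summit.BirchSwinnertonDyer.Rank1Residual.ManinAdditive.TowerExtension

namespace Summit.BirchSwinnertonDyer.Rank1Residual.ManinAdditive.KatoCurve

/-- **E-an-135 ⟹ E-an-135♭ PROVED** (typer g15; an's bookkeeping edge `TowerImpliesSome`): Dirichlet's theorem supplies,
beyond any bound, a prime `q ≡ −1 (mod 4p)` — hence `q` odd, `q ≠ p`, `q ∤ N` (take `q > N`) and `p ∤ (q−1)/2 = 2p·j − 1` —
at which the tower law E-an-135 applies verbatim. -/
theorem towerImpliesSome_holds : TowerImpliesSome := by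
  intro p hp hT _ W _ N _ f hW hpi N₀
  have hp2 : 2 ≤ p := hp.two_le
  have h4p : 4 * p ≠ 0 := by omega
  have hcop : (4 * p - 1).Coprime (1 + (4 * p - 1)) := Nat.coprime_add_self_right.mpr (Nat.coprime_one_right _)
  have h41 : 1 + (4 * p - 1) = 4 * p := by omega
  rw [h41] at hcop
  obtain ⟨q, hqgt, hq, hqmod⟩ := Nat.forall_exists_prime_gt_and_modEq (N₀ + N + p) h4p hcop
  -- `q + 1 = 4·p·(k+1)`
  have hmod : q % (4 * p) = 4 * p - 1 := by
    rw [Nat.ModEq] at hqmod; rw [hqmod]; exact Nat.mod_eq_of_lt (by omega)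
  have hdiv := Nat.div_add_mod q (4 * p)
  set k := q / (4 * p) with hk
  set M := p * (k + 1) with hM
  have hqM : q + 1 = 4 * M := by
    rw [hmod] at hdiv
    have h1 : 1 ≤ 4 * p := by omega
    zify [h1] at hdiv ⊢
    rw [hM]; push_cast
    linear_combination -hdiv
  have hpM : p ≤ M := by rw [hM]; exact Nat.le_mul_of_pos_right p (Nat.succ_pos k)
  have hNpos : 0 < N := Nat.pos_of_ne_zero (NeZero.ne N)
  have hq2 : q ≠ 2 := by omega
  have hqp : q ≠ p := by omega
  have hqN : ¬ q ∣ N := fun h => by have := Nat.le_of_dvd hNpos h; omega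
  have hhalf : (q - 1) / 2 = 2 * M - 1 := by omega
  have hpdiv : ¬ p ∣ (q - 1) / 2 := by
    rw [hhalf]
    intro h
    have h2M : p ∣ 2 * M := ⟨2 * (k + 1), by rw [hM]; ring⟩
    have h1 : p ∣ 2 * M - (2 * M - 1) := Nat.dvd_sub h2M h
    have : 2 * M - (2 * M - 1) = 1 := by omega
    rw [this] at h1
    exact hp.one_lt.ne' (Nat.dvd_one.mp h1)
  haveI : Fact q.Prime := ⟨hq⟩
  exact ⟨q, ⟨hq⟩, by omega, hq2, hqp, hqN, hpdiv, fun n₁ => hT W f hW hpi q hq2 hqp hqN hpdiv n₁⟩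

end Summit.BirchSwinnertonDyer.Rank1Residual.ManinAdditive.KatoCurve

end
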